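import Literature.Combinatorics.SimpleGraph.OrderedRefinementStable
import HarnessLib

/-!
# Ordered colour refinement: order and kernel are stationary after `|V| - 1` rounds

`OrderedRefinementStable.lean` shows that round `t` of ordered colour refinement `ocrIter G col t` splits
nothing once `|V| ≤ t + 1` (`iterStable_of_card_le`).  A circuit that runs a FIXED number `T ≥ |V| - 1` of
rounds (the refinement module of a symmetric canoniser, `SymmetricThresholdProgramsRefineIter.lean`) and a
definition that runs exactly `|V|` rounds (`refineIn` of the per-path Corneil–Goldberg process) must agree; they
do, in the only two respects any later step reads — the ORDER and the KERNEL of the colouring: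

* `ocrIter_succ_lt_iff_of_stable` — at a stable round the next round has the same order (it has the same
  kernel by stability);
* `ocrIter_lt_iff_of_stable_le`, `ocrIter_eq_iff_of_stable_le` — hence every later round has the order and
  kernel of the stable one;
* `ocrIter_lt_iff_of_card_le`, `ocrIter_eq_iff_of_card_le` — any two rounds `s, t` with `|V| ≤ s + 1`,
  `|V| ≤ t + 1` have the same order and the same kernel.

## References
* S. Kiefer, B. D. McKay, *The iteration number of colour refinement*, ICALP 2020, Def. 3, Cor. 6
  [KieferMcKay2020].
-/

namespace Literature.Combinatorics.SimpleGraph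

open _root_.SimpleGraph Finset

universe u

variable {V : Type u} [Fintype V] {G : _root_.SimpleGraph V} [DecidableRel G.Adj]

/-- **At a stable round the next round has the same order.** [cite: KieferMcKay2020, Def. 3 (stable colouring)] -/
theorem ocrIter_succ_lt_iff_of_stable {col : V → ℕ} {t : ℕ}
    (h : ∀ u v : V, ocrIter G col (t + 1) u = ocrIter G col (t + 1) v ↔ ocrIter G col t u = ocrIter G col t v)
    (a b : V) : ocrIter G col (t + 1) a < ocrIter G col (t + 1) b ↔ ocrIter G col t a < ocrIter G col t b := by
  rw [ocrIter_succ]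
  constructor
  · intro hab
    rcases lt_trichotomy (ocrIter G col t a) (ocrIter G col t b) with h' | h' | h'
    · exact h'
    · rw [← ocrIter_succ] at hab
      exact absurd ((h a b).2 h') hab.ne
    · exact absurd hab (not_lt.2 (ocrStep_lt_of_lt h').le)
  · exact fun hab => ocrStep_lt_of_lt hab

/-- **Every round after a stable one has its order.** [folklore] -/
theorem ocrIter_lt_iff_of_stable_le {col : V → ℕ} {s t : ℕ} (hst : s ≤ t)
    (h : ∀ u v : V, ocrIter G col (s + 1) u = ocrIter G col (s + 1) v ↔ ocrIter G col s u = ocrIter G col s v)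
    (a b : V) : ocrIter G col t a < ocrIter G col t b ↔ ocrIter G col s a < ocrIter G col s b := by
  induction t, hst using Nat.le_induction with
  | base => exact Iff.rfl
  | succ t hst ih => rw [ocrIter_succ_lt_iff_of_stable (iterStable_of_le hst h) a b, ih]

/-- **Every round after a stable one has its kernel.** [folklore] -/
theorem ocrIter_eq_iff_of_stable_le {col : V → ℕ} {s t : ℕ} (hst : s ≤ t)
    (h : ∀ u v : V, ocrIter G col (s + 1) u = ocrIter G col (s + 1) v ↔ ocrIter G col s u = ocrIter G col s v)
    (a b : V) : ocrIter G col t a = ocrIter G col t b ↔ ocrIter G col s a = ocrIter G col s b := by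
  induction t, hst using Nat.le_induction with
  | base => exact Iff.rfl
  | succ t hst ih => rw [iterStable_of_le hst h a b, ih]

/-- **Rounds beyond `|V| - 1` have one and the same ORDER.** [cite: KieferMcKay2020, Cor. 6] -/
theorem ocrIter_lt_iff_of_card_le (col : V → ℕ) {s t : ℕ} (hs : Fintype.card V ≤ s + 1)
    (ht : Fintype.card V ≤ t + 1) (a b : V) :
    ocrIter G col s a < ocrIter G col s b ↔ ocrIter G col t a < ocrIter G col t b := by
  have key : ∀ {r : ℕ}, Fintype.card V ≤ r + 1 →
      (ocrIter G col r a < ocrIter G col r b ↔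
        ocrIter G col (Fintype.card V - 1) a < ocrIter G col (Fintype.card V - 1) b) := by
    intro r hr
    exact ocrIter_lt_iff_of_stable_le (by omega) (iterStable_of_card_le col (by omega)) a b
  rw [key hs, key ht]

/-- **Rounds beyond `|V| - 1` have one and the same KERNEL.** [cite: KieferMcKay2020, Cor. 6] -/
theorem ocrIter_eq_iff_of_card_le (col : V → ℕ) {s t : ℕ} (hs : Fintype.card V ≤ s + 1)
    (ht : Fintype.card V ≤ t + 1) (a b : V) :
    ocrIter G col s a = ocrIter G col s b ↔ ocrIter G col t a = ocrIter G col t b := by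
  have key : ∀ {r : ℕ}, Fintype.card V ≤ r + 1 →
      (ocrIter G col r a = ocrIter G col r b ↔
        ocrIter G col (Fintype.card V - 1) a = ocrIter G col (Fintype.card V - 1) b) := by
    intro r hr
    exact ocrIter_eq_iff_of_stable_le (by omega) (iterStable_of_card_le col (by omega)) a b
  rw [key hs, key ht]

end Literature.Combinatorics.SimpleGraph
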